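import Literature.Analysis.FluidPDE.ForcedOseenResidualBound
import Literature.Analysis.UnboundedOperators.HeatExtensionJointSmooth
import HarnessLib

/-!
# The forced Oseen representation POINTWISE and from any base time; joint continuity of the
# heat Duhamel integral of a bounded continuous force

Analysis/FluidPDE proof file (theorems only; no definitions, no named facts, no `sorry`).

The tree holds the forced Oseen representation of a bounded classical finite-energy solution
`u(t) = e^{νtΔ}u(0) − B^ν_0(u,u)(t) + ∫₀ᵗ e^{ν(t−τ)Δ} g(τ) dτ` ALMOST EVERYWHERE from the base time `0`
(`IsClassicalNSSolutionOn.ae_eq_forced_oseenMild`, Lemarié-Rieusset 2016, Thm. 6.1 with Prop. 6.5),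
and g10 of the cell `ns-blowup` turned it into a pointwise BOUND of the residual between any two times
(`IsClassicalNSSolutionOn.norm_oseenResidual_le_forced`), never evaluating the force term. This file
evaluates it:

* `continuous_uncurry_forceDuhamel` — for a jointly continuous force bounded by `G` on `ℝ × E` and
  `ν > 0`, the heat Duhamel integral `(t, x) ↦ ∫_{(s,t)} e^{ν(t−τ)Δ} g(τ)(x) dτ` (`forceDuhamel ν s g`)
  is JOINTLY CONTINUOUS on `ℝ × E` (dominated convergence on a fixed time window: the integrand is
  bounded by `G` and, for `τ ≠ t₀`, continuous in `(t, x)` at `(t₀, x₀)` by the joint smoothness of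
  the caloric extension, `contDiffOn_heatExtension_prod`); `continuous_forceDuhamel_slice`;
* `forceDuhamel_translate` — `∫ₛᵗ e^{ν(t−τ)Δ} g(τ + c) dτ = ∫_{s+c}^{t+c} e^{ν(t+c−τ)Δ} g(τ) dτ`;
* `IsClassicalNSSolutionOn.eq_forced_oseenMild_of_bounded` — **the forced Oseen identity from ANY
  base time, at EVERY point**: for a classical solution on `[0, T] × ℝ³` (`ν > 0`) driven by a
  jointly continuous force `g`, bounded by `G`, with weakly divergence-free square-integrable slices
  on `[0, T]`, of finite energy and bounded by `M`: for all `0 ≤ s < t ≤ T` and every `x`,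
  `u(t, x) = e^{ν(t−s)Δ}u(s)(x) − B^ν_s(u,u)(t)(x) + ∫ₛᵗ e^{ν(t−τ)Δ} g(τ)(x) dτ` (the a.e. identity
  of the time translate, and continuity in `x` of all four terms).

Consumer: the blow-up profile of a Clay blow-up WITH force
(`Summits/NavierStokesRegularity/FluidComputer/ClayBlowupForcedProfile.lean`, seat ecbridge-2 g11).

## Mathlib / tree search

Tree: `IsClassicalNSSolutionOn.ae_eq_forced_oseenMild` (`ForcedOseenRepresentationClassical`),
`oseenDuhamel_translate`, `continuous_oseenDuhamel_slice` (`NSBoundedMildSmoothing`),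
`stronglyMeasurable_forceDuhamelIntegrand_slice`, `norm_forceDuhamel_le` (`ForcedOseenRepresentation`),
`UnboundedOperators.contDiffOn_heatExtension_prod` (`HeatExtensionJointSmooth`),
`UnboundedOperators.norm_heatExtension_le`, `UnboundedOperators.memLp_top_of_continuous_of_bound`,
`UnboundedOperators.contDiff_heatExtension_of_bound`. `lean search 'continuous.*forceDuhamel'`:
only the weighted `continuous_oseenForceDuhamel_of_weight` (a different object). Mathlib:
`continuousAt_of_dominated`, `MeasurePreserving.setIntegral_preimage_emb`, `Continuous.ae_eq_iff_eq`.

## References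

* P. G. Lemarié-Rieusset, *The Navier–Stokes Problem in the 21st Century*, CRC Press 2016,
  Thm. 6.1 (6.12) with Prop. 6.5 (pp. 133–136). [LemarieRieusset2016]
* G. Koch, N. Nadirashvili, G. Seregin, V. Šverák, Acta Math. 203 (2009) = arXiv:0709.3599, §4 (i)
  ((4.3)–(4.4): the restarted integral equation). [KochNadirashviliSereginSverak2009]
-/

noncomputable section

open MeasureTheory TopologicalSpace Set Function Filter Metric
open _root_.Topology
open scoped ENNReal NNReal RealInnerProductSpace

namespace Literature.Analysis.FluidPDE

/-! ## §1 Joint continuity of the heat Duhamel integral of a bounded continuous force -/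

section ForceDuhamel

variable {E : Type*} [NormedAddCommGroup E] [InnerProductSpace ℝ E] [FiniteDimensional ℝ E]
  [MeasurableSpace E] [BorelSpace E]

variable {ν s G : ℝ} {g : ℝ → E → E}

/-- **Time translation of the heat Duhamel integral of a force**:
`∫_{(s,t)} e^{ν(t−τ)Δ} g(τ + c) dτ = ∫_{(s+c, t+c)} e^{ν(t+c−τ)Δ} g(τ) dτ` (the substitution
`τ ↦ τ + c`). [cite: LemarieRieusset2016, Thm. 6.1 (6.12)] -/
theorem forceDuhamel_translate (ν s c : ℝ) (g : ℝ → E → E) (t : ℝ) (x : E) :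
    forceDuhamel ν s (fun τ => g (τ + c)) t x = forceDuhamel ν (s + c) g (t + c) x := by
  simp only [forceDuhamel_apply]
  have h := (measurePreserving_add_right (volume : Measure ℝ) c).setIntegral_preimage_emb
    (measurableEmbedding_addRight c)
    (fun τ => UnboundedOperators.heatExtension (g τ) (ν * (t + c - τ)) x) (Ioo (s + c) (t + c))
  rw [preimage_add_const_Ioo, add_sub_cancel_right, add_sub_cancel_right] at h
  rw [← h]
  refine setIntegral_congr_fun measurableSet_Ioo fun τ _ => ?_
  simp only [add_sub_add_right_eq_sub]

/-- **The heat Duhamel integral of a bounded jointly continuous force is jointly continuous**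
(`ν > 0`, `‖g‖ ≤ G` on `ℝ × E`): `(t, x) ↦ forceDuhamel ν s g t x` is continuous on `ℝ × E`.
Dominated convergence on the fixed time window `(s, t₀ + 1)`: the integrand
`1_{τ < t} e^{ν(t−τ)Δ} g(τ)(x)` is bounded by `G` and, for every `τ ≠ t₀`, continuous in `(t, x)` at
`(t₀, x₀)` (joint smoothness of the caloric extension of the bounded slice `g(τ)` for `τ < t₀`;
identically `0` near `(t₀, x₀)` for `τ > t₀`). [cite: LemarieRieusset2016, Thm. 6.1 (6.12) with Prop. 6.5 (pp. 133–136)] -/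
theorem continuous_uncurry_forceDuhamel (hν : 0 < ν) (hgc : Continuous (uncurry g))
    (hG : ∀ τ y, ‖g τ y‖ ≤ G) : Continuous (uncurry (forceDuhamel ν s g)) := by
  have hG0 : 0 ≤ G := (norm_nonneg _).trans (hG 0 0)
  have hgm : StronglyMeasurable (uncurry g) := hgc.stronglyMeasurable
  have hgslc : ∀ τ, Continuous (g τ) := fun τ => hgc.comp (continuous_const.prodMk continuous_id)
  rw [continuous_iff_continuousAt]
  rintro ⟨t₀, x₀⟩
  -- the fixed window `(s, T')`, `T' = t₀ + 1`
  set T' : ℝ := t₀ + 1 with hT'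
  set μ : Measure ℝ := (volume : Measure ℝ).restrict (Ioo s T') with hμ
  set Φ : ℝ × E → ℝ → E := fun q τ =>
    (Iio q.1).indicator (fun τ => UnboundedOperators.heatExtension (g τ) (ν * (q.1 - τ)) q.2) τ with hΦ
  -- `forceDuhamel = ∫ Φ ∂μ` for `t < T'`
  have hrepr : ∀ q : ℝ × E, q.1 < T' → uncurry (forceDuhamel ν s g) q = ∫ τ, Φ q τ ∂μ := by
    rintro ⟨t, x⟩ ht
    have hset : Ioo s T' ∩ Iio t = Ioo s t := by
      ext τ
      simp only [mem_inter_iff, mem_Iio, mem_Ioo]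
      constructor
      · rintro ⟨⟨h1, -⟩, h2⟩; exact ⟨h1, h2⟩
      · rintro ⟨h1, h2⟩; exact ⟨⟨h1, h2.trans ht⟩, h2⟩
    simp only [uncurry_apply_pair, forceDuhamel_apply, hΦ, hμ]
    rw [setIntegral_indicator measurableSet_Iio, hset]
  have hnear : ∀ᶠ q : ℝ × E in 𝓝 (t₀, x₀), q.1 < T' :=
    (isOpen_lt continuous_fst continuous_const).mem_nhds (by simp [hT'])
  -- ### dominated convergence
  have hkey : ContinuousAt (fun q : ℝ × E => ∫ τ, Φ q τ ∂μ) (t₀, x₀) := by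
    refine continuousAt_of_dominated (bound := fun _ => G) ?_ ?_ ?_ ?_
    · -- measurability of the integrands
      refine Eventually.of_forall fun q => ?_
      exact ((stronglyMeasurable_forceDuhamelIntegrand_slice hgm ν q.1 q.2).indicator
        measurableSet_Iio).aestronglyMeasurable
    · -- the uniform bound `G`
      refine Eventually.of_forall fun q => Eventually.of_forall fun τ => ?_
      simp only [hΦ]
      by_cases hτ : τ ∈ Iio q.1
      · rw [indicator_of_mem hτ]
        exact UnboundedOperators.norm_heatExtension_le (hG τ) (mul_pos hν (sub_pos.2 hτ)) q.2
      · rw [indicator_of_notMem hτ, norm_zero]; exact hG0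
    · rw [hμ]
      exact integrableOn_const (measure_Ioo_lt_top.ne)
    · -- continuity in `q` at `(t₀, x₀)` for `τ ≠ t₀`
      have hae : ∀ᵐ τ ∂μ, τ ≠ t₀ := by
        rw [hμ]
        refine ae_restrict_of_ae ?_
        filter_upwards [compl_mem_ae_iff.2 (measure_singleton t₀ : (volume : Measure ℝ) {t₀} = 0)]
          with τ hτ
        simpa using hτ
      filter_upwards [hae] with τ hτ
      rcases lt_or_gt_of_ne hτ with hlt | hgt
      · -- `τ < t₀`: the integrand is the caloric extension near `(t₀, x₀)`
        have hmem : (Ioi τ ×ˢ (univ : Set E)) ∈ 𝓝 ((t₀, x₀) : ℝ × E) :=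
          (isOpen_Ioi.prod isOpen_univ).mem_nhds ⟨hlt, mem_univ _⟩
        have heq : (fun q : ℝ × E => Φ q τ) =ᶠ[𝓝 (t₀, x₀)]
            fun q : ℝ × E => UnboundedOperators.heatExtension (g τ) (ν * (q.1 - τ)) q.2 := by
          filter_upwards [hmem] with q hq
          simp only [hΦ, indicator_of_mem (show τ ∈ Iio q.1 from hq.1)]
        refine ContinuousAt.congr ?_ heq.symm
        have hsm := UnboundedOperators.contDiffOn_heatExtension_prod
          (UnboundedOperators.memLp_top_of_continuous_of_bound (hgslc τ) (hG τ)) le_top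
        have hpt : (ν * (t₀ - τ), x₀) ∈ Ioi (0 : ℝ) ×ˢ (univ : Set E) :=
          ⟨mul_pos hν (sub_pos.2 hlt), mem_univ _⟩
        have hca : ContinuousAt (fun r : ℝ × E => UnboundedOperators.heatExtension (g τ) r.1 r.2)
            (ν * (t₀ - τ), x₀) :=
          (hsm.continuousOn.continuousWithinAt hpt).continuousAt
            ((isOpen_Ioi.prod isOpen_univ).mem_nhds hpt)
        have hmap : Continuous (fun q : ℝ × E => (ν * (q.1 - τ), q.2)) :=
          (continuous_const.mul (continuous_fst.sub continuous_const)).prodMk continuous_snd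
        have hcomp := ContinuousAt.comp
          (f := fun q : ℝ × E => (ν * (q.1 - τ), q.2))
          (g := fun r : ℝ × E => UnboundedOperators.heatExtension (g τ) r.1 r.2)
          (x := (t₀, x₀)) hca hmap.continuousAt
        exact hcomp
      · -- `τ > t₀`: the integrand vanishes near `(t₀, x₀)`
        have hmem : (Iio τ ×ˢ (univ : Set E)) ∈ 𝓝 ((t₀, x₀) : ℝ × E) :=
          (isOpen_Iio.prod isOpen_univ).mem_nhds ⟨hgt, mem_univ _⟩
        have heq : (fun q : ℝ × E => Φ q τ) =ᶠ[𝓝 (t₀, x₀)] fun _ => 0 := by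
          filter_upwards [hmem] with q hq
          have : τ ∉ Iio q.1 := fun h => lt_irrefl _ ((mem_Iio.1 h).trans hq.1)
          simp only [hΦ, indicator_of_notMem this]
        exact (continuousAt_const.congr heq.symm)
  refine hkey.congr ?_
  filter_upwards [hnear] with q hq
  exact (hrepr q hq).symm

/-- The slices `x ↦ forceDuhamel ν s g t x` of the heat Duhamel integral of a bounded jointly
continuous force are continuous. [cite: LemarieRieusset2016, Thm. 6.1 (6.12) with Prop. 6.5 (pp. 133–136)] -/
theorem continuous_forceDuhamel_slice (hν : 0 < ν) (hgc : Continuous (uncurry g))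
    (hG : ∀ τ y, ‖g τ y‖ ≤ G) (t : ℝ) : Continuous (forceDuhamel ν s g t) :=
  (continuous_uncurry_forceDuhamel (s := s) hν hgc hG).comp (Continuous.prodMk_right t)

end ForceDuhamel

/-! ## §2 The forced Oseen identity from any base time, pointwise -/

section Pointwise

variable {ν T M G : ℝ} {g u : ℝ → EuclideanSpace ℝ (Fin 3) → EuclideanSpace ℝ (Fin 3)}
  {p : ℝ → EuclideanSpace ℝ (Fin 3) → ℝ}

/-- **The forced Oseen representation from ANY base time, at EVERY point** (Lemarié-Rieusset 2016,
Thm. 6.1 (6.12), for the time translate, plus continuity of the four terms). Let `(u, p)` be a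
classical solution of the Navier–Stokes system (`ν > 0`) on `[0, T] × ℝ³` driven by a jointly
continuous force `g`, `‖g‖ ≤ G` on `ℝ × ℝ³`, with weakly divergence-free slices and
`‖g(τ)‖_{L²} ≤ G₂ < ∞` on `[0, T]`, of finite energy and bounded by `M` on the slab. Then for all
`0 ≤ s < t ≤ T` and every `x`,
`u(t, x) = e^{ν(t−s)Δ}u(s)(x) − B^ν_s(u,u)(t)(x) + ∫ₛᵗ e^{ν(t−τ)Δ} g(τ)(x) dτ`.
[cite: LemarieRieusset2016, Thm. 6.1 (6.12) with Prop. 6.5 (pp. 133–136)]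
[cite: KochNadirashviliSereginSverak2009, §4 (i) (4.3)–(4.4) (arXiv:0709.3599 p. 8)] -/
theorem IsClassicalNSSolutionOn.eq_forced_oseenMild_of_bounded
    (hcl : IsClassicalNSSolutionOn (Icc 0 T) ν g u p) (hν : 0 < ν)
    (hgc : Continuous (uncurry g)) (hG : ∀ τ y, ‖g τ y‖ ≤ G)
    (hgdiv : ∀ τ ∈ Icc 0 T, IsWeaklyDivFree (g τ)) {G₂ : ℝ≥0∞} (hG₂ : G₂ ≠ ⊤)
    (hg2 : ∀ τ ∈ Icc 0 T, eLpNorm (g τ) 2 volume ≤ G₂)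
    (hE : ∃ C : ℝ≥0∞, C < ⊤ ∧ ∀ t ∈ Icc 0 T, ∫⁻ x, ‖u t x‖ₑ ^ 2 ≤ C)
    (hM : 0 < M) (hbd : ∀ t ∈ Icc 0 T, ∀ y, ‖u t y‖ ≤ M)
    {s t : ℝ} (hs : 0 ≤ s) (hst : s < t) (htT : t ≤ T) (x : EuclideanSpace ℝ (Fin 3)) :
    u t x = UnboundedOperators.heatExtension (u s) (ν * (t - s)) x - oseenDuhamel ν s u u t x +
      forceDuhamel ν s g t x := by
  have hts : 0 < t - s := sub_pos.2 hst
  -- ### the time-translated solution on `[0, t - s]`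
  have hsubI : ∀ τ ∈ Icc 0 (t - s), τ + s ∈ Icc 0 T := fun τ hτ =>
    ⟨by linarith [hτ.1], by linarith [hτ.2]⟩
  have hcl' : IsClassicalNSSolutionOn (Icc 0 (t - s)) ν (fun τ => g (τ + s)) (fun τ => u (τ + s))
      (fun τ => p (τ + s)) :=
    (hcl.comp_add_right s).mono (fun τ hτ => hsubI τ hτ) (uniqueDiffOn_Icc hts)
  have hgc' : Continuous (uncurry fun τ => g (τ + s)) :=
    hgc.comp ((continuous_fst.add continuous_const).prodMk continuous_snd)
  have hG' : ∀ τ ∈ Icc 0 (t - s), ∀ y, ‖(fun τ => g (τ + s)) τ y‖ ≤ G := fun τ _ y => hG (τ + s) y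
  have hgdiv' : ∀ τ ∈ Icc 0 (t - s), IsWeaklyDivFree ((fun τ => g (τ + s)) τ) := fun τ hτ =>
    hgdiv (τ + s) (hsubI τ hτ)
  have hg2' : ∀ τ ∈ Icc 0 (t - s), eLpNorm ((fun τ => g (τ + s)) τ) 2 volume ≤ G₂ := fun τ hτ =>
    hg2 (τ + s) (hsubI τ hτ)
  have hE' : ∃ C : ℝ≥0∞, C < ⊤ ∧ ∀ τ ∈ Icc 0 (t - s), ∫⁻ y, ‖(fun τ => u (τ + s)) τ y‖ₑ ^ 2 ≤ C := by
    obtain ⟨C, hC, hb⟩ := hE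
    exact ⟨C, hC, fun τ hτ => hb (τ + s) (hsubI τ hτ)⟩
  have hbd' : ∀ τ ∈ Icc 0 (t - s), ∀ y, ‖(fun τ => u (τ + s)) τ y‖ ≤ M := fun τ hτ y =>
    hbd (τ + s) (hsubI τ hτ) y
  -- ### the representation from the base time `s`, a.e.
  have hrep := hcl'.ae_eq_forced_oseenMild hν hts hgc' hG' hgdiv' hG₂ hg2' hE' hM hbd'
    (t := t - s) ⟨hts, le_rfl⟩
  have e3 : ∀ y, oseenDuhamel ν 0 (fun τ => u (τ + s)) (fun τ => u (τ + s)) (t - s) y =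
      oseenDuhamel ν s u u t y := fun y => by
    rw [oseenDuhamel_translate ν 0 s u u (t - s) y, zero_add, sub_add_cancel]
  have e4 : ∀ y, forceDuhamel ν 0 (fun τ => g (τ + s)) (t - s) y = forceDuhamel ν s g t y := fun y => by
    rw [forceDuhamel_translate ν 0 s g (t - s) y, zero_add, sub_add_cancel]
  rw [sub_add_cancel, zero_add] at hrep
  have hae : u t =ᵐ[volume] fun y =>
      UnboundedOperators.heatExtension (u s) (ν * (t - s)) y - oseenDuhamel ν s u u t y +
        forceDuhamel ν s g t y := by
    filter_upwards [hrep] with y hy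
    rw [hy, e3 y, e4 y]
  -- ### both sides are continuous in `x`
  have htI : t ∈ Icc 0 T := ⟨hs.trans hst.le, htT⟩
  have hsI : s ∈ Icc 0 T := ⟨hs, hst.le.trans htT⟩
  have hcu : ∀ τ ∈ Icc 0 T, Continuous (u τ) := fun τ hτ => (hcl.contDiff_velocity hτ).continuous
  have hheat : Continuous (UnboundedOperators.heatExtension (u s) (ν * (t - s))) :=
    (UnboundedOperators.contDiff_heatExtension_of_bound (m := 0) (hcu s hsI) (fun z => hbd s hsI z)
      (mul_pos hν hts)).continuous
  have hmeas : AEStronglyMeasurable (uncurry u)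
      ((volume : Measure (ℝ × EuclideanSpace ℝ (Fin 3))).restrict (Ioo s t ×ˢ univ)) := by
    have hsub : Ioo s t ×ˢ (univ : Set (EuclideanSpace ℝ (Fin 3))) ⊆ Icc 0 T ×ˢ univ :=
      Set.prod_mono (fun τ hτ => ⟨hs.trans hτ.1.le, hτ.2.le.trans htT⟩) subset_rfl
    exact (hcl.smooth_velocity.continuousOn.mono hsub).aestronglyMeasurable
      (measurableSet_Ioo.prod MeasurableSet.univ)
  have hbdo : ∀ τ ∈ Ioo s t, ∀ y, ‖u τ y‖ ≤ M := fun τ hτ y =>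
    hbd τ ⟨hs.trans hτ.1.le, hτ.2.le.trans htT⟩ y
  have hB : Continuous (oseenDuhamel ν s u u t) :=
    continuous_oseenDuhamel_slice hν hM.le hmeas hmeas hbdo hbdo hst le_rfl
  have hF : Continuous (forceDuhamel ν s g t) := continuous_forceDuhamel_slice hν hgc hG t
  have heq := (Continuous.ae_eq_iff_eq volume (hcu t htI) ((hheat.sub hB).add hF)).1 hae
  exact congrFun heq x

end Pointwise

end Literature.Analysis.FluidPDE

end
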